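import Literature.NumberTheory.EllipticCurves.ModularityVersionApProofs
import Literature.NumberTheory.EllipticCurves.CuspFormLFunctionNewformFrickeProofs
import Literature.NumberTheory.EllipticCurves.RootNumberTwistSemistableProofs
import Literature.NumberTheory.EllipticCurves.NewformsLevelEqOfHeckeEigenvalueEqProofs
import HarnessLib

/-!
# Level `=` conductor for the newform of a SEMISTABLE elliptic curve, proved
# (the squarefree case of `IsNewformOf.level_eq_conductorNorm`, Carayol's theorem, in `CuspFormLFunction`)

`CuspFormLFunction.lean` states as a named fact (D-0014)

  `IsNewformOf.level_eq_conductorNorm : ∀ {W} [W.IsElliptic] {f : S₂(Γ₀(N))}, IsNewformOf W f → N = N_W`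

(Carayol 1986; Diamond–Shurman Thm. 8.8.1: the newform `f` with `aₙ(f) = aₙ(E)` for all `n` has level
the conductor `N_E`). In general this is a deep theorem (the conductor of the `λ`-adic representation
of `f` is its level, Carayol; and it is the conductor of `E`, Ogg–Saito). This file proves, by
`q`-expansion arithmetic alone, as much of it as the Fourier coefficients see:

* `IsNewformOf.dvd_level_iff_dvd_conductorNorm` — for EVERY elliptic `W` and every prime `p`:
  `p ∣ N ↔ p ∣ N_W` (the level and the conductor have the same prime divisors). Compare the
  `p²`-coefficients: `a_{p²}(f) = a_p(f)² - 𝟙_N(p) p` for the normalised eigenform `f`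
  (Diamond–Shurman Prop. 5.8.5, `IsNewform0.cuspCoeff_prime_pow_add_two`) and
  `a_{p²}(E) = a_p(E)² - 𝟙_{N_E}(p) p` for Mathlib's `WeierstrassCurve.LFunction`
  (Diamond–Shurman (8.44) with §8.3, `WeierstrassCurve.LFunction_apply_prime_pow_add_two_of_prime`,
  which rests on `f_p = 0 ↔` good reduction, Silverman ATAEC IV.10.2(a), discharged in the tree), so
  `𝟙_N(p) = 𝟙_{N_E}(p)`.
* `cuspCoeff_eq_zero_of_sq_dvd_of_mem_newSubspace0` — `p² ∣ N ⇒ a_p(f) = 0` for every `f` in the new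
  subspace (Atkin–Lehner 1970, Thm. 3; Knapp 1993, Lemma 9.26 / Thm. 9.27: "`c_p = 0` if `p² ∣ N`";
  here from the tree's kernel form `heckeT_eq_zero_of_adjDegeneracyMap0_eq_zero` of Knapp's Lemma 9.26
  and the `q`-expansion of `U_p`, `qExpansion_coeff_heckeT_holds`).
* `WeierstrassCurve.LFunction_apply_ne_zero_of_dvd_of_squarefree` — for `N_W` squarefree and
  `p ∣ N_W`: `a_p(E) = ±1 ≠ 0` (multiplicative reduction; Silverman AEC §C.16, the local factors
  `1 ∓ T`; the tree's `LFunction_apply_primesEquiv_of_…` and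
  `not_hasAdditiveReductionAt_of_squarefree_conductorNorm`).
* `IsNewformOf.level_eq_conductorNorm_of_squarefree` — **for a semistable `W` (squarefree conductor)
  and its newform `f ∈ S₂(Γ₀(N))` at any level: `N = N_W`.** By the three items `N` is squarefree with
  the prime divisors of `N_W`. This is the case of Carayol's theorem that the Fourier coefficients
  decide; at an additive prime `p` of `W` (`a_p(E) = 0`, `p² ∣ N_E`) the same argument gives only
  `p ∣ N`, the exponent being invisible to `(aₙ)`.
* `IsNewformOf.level_eq_conductorNorm_of_squarefree'` — the same packaged in the shape of the named
  fact restricted to semistable curves.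
* `IsNewformOf.level_eq_level` (section `Modularity`) — two newforms of the same `W`, at levels
  `N` and `N'`, have `N = N'`: they share the Hecke eigenvalues `a_p(W)` at every prime, so this is
  **strong multiplicity one across levels** (Atkin–Lehner 1970, Thm. 4), a theorem of the tree
  (`IsNewform0.level_eq_of_heckeEigenvalue_eq_holds`, `NewformsLevelEqOfHeckeEigenvalueEqProofs`);
  unconditional. Hence `IsNewformOf.level_eq_conductorNorm_of_exists_conductorLevel` (one newform of
  `W` at level `N_W` pins the level of all of them) and
  `IsNewformOf.level_eq_conductorNorm_of_exists_isNewformOf` — **for EVERY elliptic `W`, Carayol's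
  level theorem follows from the modularity theorem in the tree's form `exists_isNewformOf`** (a
  newform of `W` at level `N_W`; Breuil–Conrad–Diamond–Taylor 2001, Thm. A with Diamond–Shurman
  Thm. 8.8.1). So over the tree the named fact `IsNewformOf.level_eq_conductorNorm` carries no
  obligation beyond `exists_isNewformOf` (`IsNewformOf.level_eq_conductorNorm_of_exists_isNewformOf'`
  is the fact itself, at every level, from modularity). Nothing is claimed in the converse direction.

## References

* A. O. L. Atkin, J. Lehner, *Hecke operators on `Γ₀(m)`*, Math. Ann. 185 (1970), 134–160, Thm. 3.
* A. W. Knapp, *Elliptic curves*, Princeton 1993, Lemma 9.26, Thm. 9.27 (held: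
  `book:knapp1993-elliptic-curves-volume-40`).
* F. Diamond, J. Shurman, *A first course in modular forms*, GTM 228 (2005), Prop. 5.8.5, §8.3,
  (8.44), Thm. 8.8.1 (held: `book:diamond2005-first-course-modular-forms`).
* H. Carayol, Ann. Sci. ÉNS 19 (1986), 409–468 (the general theorem; tree fact
  `IsNewformOf.level_eq_conductorNorm`).
-/

noncomputable section

open scoped MatrixGroups ModularForm

open CongruenceSubgroup UpperHalfPlane IsDedekindDomain NumberField Rat.HeightOneSpectrum

/-! ### `a_p(E) ≠ 0` at the primes of a squarefree conductor -/

namespace WeierstrassCurve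

/-- **At a prime of a squarefree conductor, `a_p(E) = ±1 ≠ 0`.** For an elliptic `W / ℚ` with
squarefree conductor and a prime `p ∣ N_W`, the reduction at the place over `p` is bad
(`not_hasGoodReductionAt_ringOfIntegers_of_dvd_conductorNorm`) and not additive
(`not_hasAdditiveReductionAt_of_squarefree_conductorNorm`: additive means `f_p ≥ 2`), hence
multiplicative, where Mathlib's local factor is `1 ∓ T` and `a_p(E) = ±1` (Silverman, *AEC*, §C.16).
[cite: SilvermanAEC2009, §C.16 (definition of L_v(T)), PDF p. 390] -/
theorem LFunction_apply_ne_zero_of_dvd_of_squarefree (W : WeierstrassCurve ℚ) [W.IsElliptic]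
    (hsq : Squarefree (W.conductorNorm ℤ)) (p : Nat.Primes) (hp : (p : ℕ) ∣ W.conductorNorm ℤ) :
    W.LFunction p ≠ 0 := by
  set v' : HeightOneSpectrum (𝓞 ℚ) := (primesEquiv (R := 𝓞 ℚ)).symm p with hv'
  have hpv' : primesEquiv v' = p := (primesEquiv (R := 𝓞 ℚ)).apply_symm_apply p
  have hbad : ¬ W.HasGoodReductionAt v' :=
    W.not_hasGoodReductionAt_ringOfIntegers_of_dvd_conductorNorm p hp
  have hna : ¬ W.HasAdditiveReductionAt v' := fun ha ↦
    W.not_hasAdditiveReductionAt_of_squarefree_conductorNorm hsq ((primesEquiv (R := ℤ)).symm p)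
      ((W.hasAdditiveReductionAt_int_iff_ringOfIntegers p).mpr ha)
  rcases hasGoodReductionAt_or_hasMultiplicativeReductionAt_or_hasAdditiveReductionAt v' W with
    hg | hm | ha
  · exact absurd hg hbad
  · rw [← hpv']
    by_cases hs : W.HasSplitMultiplicativeReductionAt v'
    · rw [W.LFunction_apply_primesEquiv_of_hasSplitMultiplicativeReductionAt hs]
      exact one_ne_zero
    · rw [W.LFunction_apply_primesEquiv_of_hasMultiplicativeReductionAt_of_not_split hm hs]
      norm_num
  · exact absurd ha hna

end WeierstrassCurve

namespace Literature.NumberTheory.EllipticCurves.ModularForms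

/-! ### `a_p(f) = 0` for `p² ∣ N` on the new subspace -/

section NewSubspace

variable {N : ℕ} [NeZero N] {k : ℤ}

/-- **`p² ∣ N ⇒ a_p(f) = 0` on `S_k(Γ₀(N))^{new}`** (Atkin–Lehner 1970, Thm. 3; Knapp 1993, Lemma 9.26
and Thm. 9.27, "`c_p = 0` if `p² ∣ N`"): write `N = p M` with `p ∣ M`; a form in the new subspace is
killed by the adjoint degeneracy map `[Γ₀(N) diag(1,p) Γ₀(M)]` (the new subspace is DEFINED as the
joint kernel of these maps, `newSubspace0`), so `U_p f = 0`
(`heckeT_eq_zero_of_adjDegeneracyMap0_eq_zero`), and `a_1(U_p f) = a_p(f)`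
(`qExpansion_coeff_heckeT_holds`, Diamond–Shurman Prop. 5.2.2(a)). No eigenform hypothesis is needed.
[cite: Knapp1993, Lemma 9.26] [cite: AtkinLehner1970, Thm. 3] -/
theorem cuspCoeff_eq_zero_of_sq_dvd_of_mem_newSubspace0 {f : CuspForm (Gamma0 N) k}
    (hf : f ∈ newSubspace0 N k) {p : ℕ} (hp : p.Prime) (hp2 : p ^ 2 ∣ N) : cuspCoeff f p = 0 := by
  haveI : Fact p.Prime := ⟨hp⟩
  obtain ⟨c, hc⟩ := hp2
  obtain ⟨M, hM⟩ : ∃ M : ℕ, M = p * c := ⟨_, rfl⟩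
  have hN : N = p * M := by rw [hc, hM]; ring
  have hpM : p ∣ M := ⟨c, hM⟩
  haveI : NeZero M := ⟨by rintro h; exact NeZero.ne N (by rw [hN, h, mul_zero])⟩
  have hMN : M ∈ N.properDivisors := Nat.mem_properDivisors.mpr
    ⟨⟨p, by rw [hN, mul_comm]⟩, by rw [hN]; exact lt_mul_left (NeZero.pos M) hp.one_lt⟩
  have hker : adjDegeneracyMap0 N M p k f = 0 := by
    have := (Submodule.mem_iInf _).mp hf ⟨(M, p), hMN, by rw [hN, mul_comm]⟩
    exact LinearMap.mem_ker.mp this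
  have hT := heckeT_eq_zero_of_adjDegeneracyMap0_eq_zero p N k hN hpM hker
  have h := qExpansion_coeff_heckeT_holds N k f p hp 1
  rw [hT, mul_one, if_pos (show p ∣ N from ⟨M, hN⟩), add_zero, CuspForm.coe_zero,
    UpperHalfPlane.qExpansion_zero, map_zero] at h
  rw [cuspCoeff]
  exact h.symm

/-- In particular **`p² ∣ N ⇒ a_p(f) = 0` for a newform `f ∈ S_k(Γ₀(N))`** (Atkin–Lehner 1970,
Thm. 3). [cite: AtkinLehner1970, Thm. 3] -/
theorem IsNewform0.cuspCoeff_eq_zero_of_sq_dvd {f : CuspForm (Gamma0 N) k} (hf : IsNewform0 f)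
    {p : ℕ} (hp : p.Prime) (hp2 : p ^ 2 ∣ N) : cuspCoeff f p = 0 :=
  cuspCoeff_eq_zero_of_sq_dvd_of_mem_newSubspace0 hf.1 hp hp2

end NewSubspace

/-! ### The newform of an elliptic curve: prime support of the level, and the semistable case -/

section Level

variable {N : ℕ} [NeZero N] {W : WeierstrassCurve ℚ} [W.IsElliptic] {f : CuspForm (Gamma0 N) 2}

/-- **The level of the newform of `E` and the conductor of `E` have the same prime divisors**, for
every elliptic `W / ℚ` and its newform `f ∈ S₂(Γ₀(N))` at any level (`IsNewformOf W f`: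
`aₙ(f) = aₙ(W)` for all `n`): compare `a_{p²}(f) = a_p(f)² - 𝟙_N(p) p` (Diamond–Shurman Prop. 5.8.5;
`IsNewform0.cuspCoeff_prime_pow_add_two`) with `a_{p²}(E) = a_p(E)² - 𝟙_{N_E}(p) p` (Diamond–Shurman
(8.44), §8.3; `WeierstrassCurve.LFunction_apply_prime_pow_add_two_of_prime`): `𝟙_N(p) p = 𝟙_{N_E}(p) p`.
(The tree's `not_dvd_level_of_isNewformOf` is the direction "good `⇒ p ∤ N`".) No input from
Carayol's theorem. [cite: DiamondShurman2005, Prop. 5.8.5 and (8.44)] -/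
theorem IsNewformOf.dvd_level_iff_dvd_conductorNorm (hf : IsNewformOf W f) {p : ℕ} (hp : p.Prime) :
    p ∣ N ↔ p ∣ W.conductorNorm ℤ := by
  have h1 := hf.1.cuspCoeff_prime_pow_add_two hp 0
  have h2 := W.LFunction_apply_prime_pow_add_two_of_prime hp 0
  simp only [zero_add, pow_one, pow_zero] at h1 h2
  have hone : W.LFunction 1 = 1 := W.isMultiplicative_LFunction.map_one
  simp only [hf.2] at h1
  rw [h2, hone] at h1
  push_cast at h1
  have hp0 : (p : ℂ) ≠ 0 := Nat.cast_ne_zero.mpr hp.ne_zero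
  have key : (if p ∣ W.conductorNorm ℤ then (0 : ℂ) else (p : ℂ)) =
      (if p ∣ N then (0 : ℂ) else (p : ℂ)) := by
    linear_combination -h1
  by_cases hN : p ∣ N <;> by_cases hNW : p ∣ W.conductorNorm ℤ
  · exact iff_of_true hN hNW
  · rw [if_pos hN, if_neg hNW] at key
    exact absurd key hp0
  · rw [if_neg hN, if_pos hNW] at key
    exact absurd key.symm hp0
  · exact iff_of_false hN hNW

/-- The level of the newform of `E` and the conductor of `E` have the same prime factors (finset
form of `IsNewformOf.dvd_level_iff_dvd_conductorNorm`). [cite: DiamondShurman2005, Prop. 5.8.5 and (8.44)] -/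
theorem IsNewformOf.primeFactors_level_eq (hf : IsNewformOf W f) :
    N.primeFactors = (W.conductorNorm ℤ).primeFactors := by
  have hN0 : N ≠ 0 := NeZero.ne N
  have hM0 : W.conductorNorm ℤ ≠ 0 := (W.conductorNorm_pos_holds).ne'
  ext p
  simp only [Nat.mem_primeFactors, ne_eq]
  constructor
  · rintro ⟨hp, hpn, -⟩
    exact ⟨hp, (hf.dvd_level_iff_dvd_conductorNorm hp).mp hpn, hM0⟩
  · rintro ⟨hp, hpn, -⟩
    exact ⟨hp, (hf.dvd_level_iff_dvd_conductorNorm hp).mpr hpn, hN0⟩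

omit [W.IsElliptic] in
/-- **`a_p(E) ≠ 0 ⇒ p² ∤ N`.** For an elliptic `W`, its newform `f ∈ S₂(Γ₀(N))` and a prime `p`
with `a_p(E) ≠ 0` (e.g. a prime of multiplicative reduction, `a_p(E) = ±1`): `p² ∤ N`, since
`p² ∣ N` forces `a_p(f) = 0` (`IsNewform0.cuspCoeff_eq_zero_of_sq_dvd`, Atkin–Lehner 1970, Thm. 3)
while `a_p(f) = a_p(E)`. With `IsNewformOf.dvd_level_iff_dvd_conductorNorm`: at a multiplicative
prime (`p ∥ N_E`) the level, too, is divisible by `p` exactly once. [cite: AtkinLehner1970, Thm. 3] -/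
theorem IsNewformOf.not_sq_dvd_level_of_lFunction_ne_zero (hf : IsNewformOf W f) {p : ℕ}
    (hp : p.Prime) (hap : W.LFunction p ≠ 0) : ¬ p ^ 2 ∣ N := by
  intro hp2
  have h0 := hf.1.cuspCoeff_eq_zero_of_sq_dvd hp hp2
  rw [hf.2 p] at h0
  exact hap (by exact_mod_cast h0)

/-- **Level `=` conductor for a semistable elliptic curve — the squarefree case of Carayol's theorem
`IsNewformOf.level_eq_conductorNorm`, proved.** Let `W / ℚ` be elliptic with squarefree conductor
`N_W` and `f ∈ S₂(Γ₀(N))` its newform at some level `N` (`IsNewformOf W f`). Then `N = N_W`.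
Proof: `N` and `N_W` have the same prime divisors (`IsNewformOf.dvd_level_iff_dvd_conductorNorm`);
for `p ∣ N_W` one has `a_p(E) = ±1 ≠ 0` (`WeierstrassCurve.LFunction_apply_ne_zero_of_dvd_of_squarefree`),
so `p² ∤ N` (`IsNewformOf.not_sq_dvd_level_of_lFunction_ne_zero`); thus `N` is squarefree as well and
`N = ∏_{p ∣ N} p = ∏_{p ∣ N_W} p = N_W`. (Atkin–Lehner 1970, Thm. 3, with Diamond–Shurman §8.3, (8.44);
for the general curve this argument leaves the exponents at the additive primes undetermined — that
is Carayol's theorem proper.) [cite: AtkinLehner1970, Thm. 3] [cite: DiamondShurman2005, Thm. 8.8.1 and (8.44)] -/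
theorem IsNewformOf.level_eq_conductorNorm_of_squarefree (hf : IsNewformOf W f)
    (hsq : Squarefree (W.conductorNorm ℤ)) : N = W.conductorNorm ℤ := by
  have hsqN : Squarefree N := by
    rw [Nat.squarefree_iff_prime_squarefree]
    intro p hp hp2
    have hpN : p ∣ N := dvd_trans (dvd_mul_right p p) hp2
    have hpW : p ∣ W.conductorNorm ℤ := (hf.dvd_level_iff_dvd_conductorNorm hp).mp hpN
    exact hf.not_sq_dvd_level_of_lFunction_ne_zero hp
      (W.LFunction_apply_ne_zero_of_dvd_of_squarefree hsq ⟨p, hp⟩ hpW) (by rwa [sq])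
  rw [← Nat.prod_primeFactors_of_squarefree hsqN, ← Nat.prod_primeFactors_of_squarefree hsq,
    hf.primeFactors_level_eq]

/-- **The named fact `IsNewformOf.level_eq_conductorNorm` restricted to semistable curves, proved**:
at every level `N`, for every elliptic `W / ℚ` with squarefree conductor and every `f ∈ S₂(Γ₀(N))`
with `IsNewformOf W f`, `N = N_W` (`IsNewformOf.level_eq_conductorNorm_of_squarefree`).
[cite: AtkinLehner1970, Thm. 3] [cite: DiamondShurman2005, Thm. 8.8.1 and (8.44)] -/
theorem IsNewformOf.level_eq_conductorNorm_of_squarefree' :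
    ∀ {W : WeierstrassCurve ℚ} [W.IsElliptic] {f : CuspForm (Gamma0 N) 2}, IsNewformOf W f →
      Squarefree (W.conductorNorm ℤ) → N = W.conductorNorm ℤ :=
  fun hf hsq ↦ hf.level_eq_conductorNorm_of_squarefree hsq

end Level

/-! ### Carayol's level theorem from modularity at the conductor level -/

section Modularity

variable {N : ℕ} [NeZero N]

/-- **Two newforms of the same elliptic curve have the same level** (and then coincide,
`IsNewformOf.unique`): `IsNewformOf W f` at level `N` and `IsNewformOf W g` at level `N'` force
`N = N'`. Both are normalised eigenforms with `T_p`-eigenvalue `a_p(f) = a_p(W) = a_p(g)` at every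
prime `p` (`heckeEigenvalue_eq_coeff_of_isNormalized`), so this is strong multiplicity one across
levels (Atkin–Lehner 1970, Thm. 4; the tree's theorem `IsNewform0.level_eq_of_heckeEigenvalue_eq_holds`
of `NewformsLevelEqOfHeckeEigenvalueEqProofs`). Unconditional. [cite: AtkinLehner1970, Thm. 4] -/
theorem IsNewformOf.level_eq_level {N' : ℕ} [NeZero N'] {W : WeierstrassCurve ℚ}
    {f : CuspForm (Gamma0 N) 2} {g : CuspForm (Gamma0 N') 2} (hf : IsNewformOf W f)
    (hg : IsNewformOf W g) : N = N' := by
  refine IsNewform0.level_eq_of_heckeEigenvalue_eq_holds hf.1 hg.1 (Set.finite_empty.subset ?_)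
  rintro p ⟨hp, hne⟩
  apply hne
  rw [heckeEigenvalue_eq_coeff_of_isNormalized hf.1.2.2 hp (hf.1.2.1 p hp),
    heckeEigenvalue_eq_coeff_of_isNormalized hg.1.2.2 hp (hg.1.2.1 p hp)]
  change cuspCoeff f p = cuspCoeff g p
  rw [hf.2 p, hg.2 p]

/-- **Modularity of one curve at its conductor level pins the level of all its newforms**: if `W`
has *some* newform at level `N_W`, every newform of `W` (at any level `N`) has `N = N_W`
(`IsNewformOf.level_eq_level`). [cite: AtkinLehner1970, Thm. 4] -/
theorem IsNewformOf.level_eq_conductorNorm_of_exists_conductorLevel {W : WeierstrassCurve ℚ}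
    [NeZero (W.conductorNorm ℤ)] (hW : ∃ g : CuspForm (Gamma0 (W.conductorNorm ℤ)) 2, IsNewformOf W g)
    {f : CuspForm (Gamma0 N) 2} (hf : IsNewformOf W f) : N = W.conductorNorm ℤ := by
  obtain ⟨g, hg⟩ := hW
  exact hf.level_eq_level hg

/-- **Level `=` conductor for EVERY elliptic curve, granted the modularity theorem.** Assume
modularity in the tree's form `exists_isNewformOf`: every elliptic `W / ℚ` has a newform
`g ∈ S₂(Γ₀(N_W))` with `aₙ(g) = aₙ(W)` for all `n` (Breuil–Conrad–Diamond–Taylor 2001, Thm. A, at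
level `N_W` as in Diamond–Shurman Thm. 8.8.1; `N_W ≥ 1` by `WeierstrassCurve.conductorNorm_pos_holds`).
Then a newform `f ∈ S₂(Γ₀(N))` with `aₙ(f) = aₙ(W)` for all `n` (`IsNewformOf W f`) has `N = N_W`, by
strong multiplicity one across levels (`IsNewformOf.level_eq_level`). This is Carayol's theorem
`IsNewformOf.level_eq_conductorNorm` for `W`, obtained from modularity in place of Carayol 1986
(compare `isNewformOf_of_cuspCoeff_prime_eq` of `EichlerShimuraConstructionReductionProofs`, the
same argument with `a_p` prescribed off a finite set). [cite: AtkinLehner1970, Thm. 4]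
[cite: DiamondShurman2005, Thm. 8.8.1] -/
theorem IsNewformOf.level_eq_conductorNorm_of_exists_isNewformOf (h₁ : exists_isNewformOf)
    {W : WeierstrassCurve ℚ} [W.IsElliptic] {f : CuspForm (Gamma0 N) 2} (hf : IsNewformOf W f) :
    N = W.conductorNorm ℤ :=
  haveI : NeZero (W.conductorNorm ℤ) := ⟨(WeierstrassCurve.conductorNorm_pos_holds W).ne'⟩
  IsNewformOf.level_eq_conductorNorm_of_exists_conductorLevel (h₁ W) hf

/-- **The named fact `IsNewformOf.level_eq_conductorNorm` at every level, from the modularity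
theorem `exists_isNewformOf`** (`IsNewformOf.level_eq_conductorNorm_of_exists_isNewformOf` in the
shape of the fact): over the tree, Carayol's level theorem carries no obligation beyond modularity.
Nothing is claimed in the converse direction. [cite: AtkinLehner1970, Thm. 4]
[cite: DiamondShurman2005, Thm. 8.8.1] -/
theorem IsNewformOf.level_eq_conductorNorm_of_exists_isNewformOf' (h₁ : exists_isNewformOf) :
    IsNewformOf.level_eq_conductorNorm (N := N) :=
  fun hf ↦ IsNewformOf.level_eq_conductorNorm_of_exists_isNewformOf h₁ hf

end Modularity

end Literature.NumberTheory.EllipticCurves.ModularForms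

end
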